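import Mathlib
import HarnessLib
import Summits.NavierStokesRegularity.NavierStokesRegularity.Theorems.TaylorModelRungThreeSoundnessVectorHigh

/-!
# Line `taylor-model` on crux K1b-DR (`ExactWindowRungThree.DerivativeEnclosureCertificateR`,
# stmt-NavierStokesRegularity-23954) — VECTOR STEP LEMMA, part 8: checker-side ADAPTERS (endpoint forms of the
# rough-enclosure tests)

The rough-enclosure hypotheses of parts 1, 3, 5, 6 quantify over `u ∈ [0,h]` (and over the box); a Boolean
checker verifies finitely many interval inequalities.  This file records the monotonicity facts that turn ENDPOINT
inequalities (what `checkStepV` will test, cf. `pub/pub-ns-dss/certificates/VECTOR-LEMMAS-23954.md` §2) into those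
hypotheses, so the soundness proof `step_of_checkStepV` is a one-liner at this point:

* `add_smul_mem_Icc_of_endpoints` — if `zlo ≤ z ≤ zhi` componentwise then
  `lo ≤ x₀ + min 0 (h·zlo)` and `x₀ + max 0 (h·zhi) ≤ hi` give `x₀ + u • z ∈ [lo,hi]` for every `u ∈ [0,h]`
  (the first-order tests (E1)/(V1)/(D1): `z = Q y y`, `Q y v + Q v y`, `Q y d + Q d y + Q d d` bounded over the
  boxes by interval evaluation, e.g. typer's `sn_qT_le_of_coordBound`);
* `roughEnclosure_of_endpoints` — the (E1) hypothesis `henc` of `exists_sol_mem_Icc_of_roughEnclosure` from a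
  componentwise enclosure `qlo ≤ Q y y ≤ qhi` on the box and the two endpoint inequalities;
* `abs_taylorPoly_sub_le` — `|Σ_{k≤p} T x₀ k c u^k − x₀ c| ≤ Σ_{1≤k≤p} R k c · h^k` on `[0,h]` from `|T x₀ k c| ≤ R k c`;
* `highOrderTest_of_endpoint` — the STRICT order-`p` test (E2) of `exists_sol_mem_Icc_of_highOrderEnclosure` from
  the single endpoint inequality `lo c < x₀ c − Σ_{1≤k≤p} R k c h^k − J c h^(p+1)`, `x₀ c + Σ … + J c h^(p+1) < hi c`.

MODEL-lattice bookkeeping only (rung TL-M3 of the NS ladder: one finite-dimensional model ODE); nothing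
here is a statement about the Navier–Stokes equations.
-/

noncomputable section

-- the sub-problem namespace repeats the summit name by design (D-0017)
set_option linter.dupNamespace false

namespace Summit.NavierStokesRegularity.NavierStokesRegularity.Theorems.TaylorModelVector

open scoped BigOperators
open Set

variable {ι : Type*}

/-- One coordinate: `0 ≤ u ≤ h` and `zlo ≤ z ≤ zhi` give `min 0 (h zlo) ≤ u z ≤ max 0 (h zhi)`. [folklore] -/
theorem mul_mem_Icc_min_max {u h z zlo zhi : ℝ} (hu : u ∈ Icc 0 h) (hz : zlo ≤ z ∧ z ≤ zhi) :
    min 0 (h * zlo) ≤ u * z ∧ u * z ≤ max 0 (h * zhi) := by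
  obtain ⟨hu0, huh⟩ := hu
  constructor
  · rcases le_or_gt 0 zlo with hzlo | hzlo
    · exact (min_le_left _ _).trans (mul_nonneg hu0 (hzlo.trans hz.1))
    · calc min 0 (h * zlo) ≤ h * zlo := min_le_right _ _
        _ ≤ u * zlo := by nlinarith
        _ ≤ u * z := by nlinarith [hz.1]
  · rcases le_or_gt zhi 0 with hzhi | hzhi
    · exact (mul_nonpos_iff.2 (Or.inl ⟨hu0, hz.2.trans hzhi⟩)).trans (le_max_left _ _)
    · calc u * z ≤ u * zhi := by nlinarith [hz.2]
        _ ≤ h * zhi := by nlinarith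
        _ ≤ max 0 (h * zhi) := le_max_right _ _

/-- **Endpoint form of `x₀ + u • z ∈ [lo,hi]`**: with `zlo ≤ z ≤ zhi` componentwise, the two inequalities
`lo ≤ x₀ + min 0 (h·zlo)` and `x₀ + max 0 (h·zhi) ≤ hi` give membership for every `u ∈ [0,h]`. [folklore] -/
theorem add_smul_mem_Icc_of_endpoints {x₀ z lo hi zlo zhi : ι → ℝ} {h u : ℝ} (hu : u ∈ Icc 0 h)
    (hz : ∀ c, zlo c ≤ z c ∧ z c ≤ zhi c) (hlo : ∀ c, lo c ≤ x₀ c + min 0 (h * zlo c))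
    (hhi : ∀ c, x₀ c + max 0 (h * zhi c) ≤ hi c) : x₀ + u • z ∈ Icc lo hi := by
  refine ⟨fun c => ?_, fun c => ?_⟩
  · have h1 := (mul_mem_Icc_min_max hu (hz c)).1
    simp only [Pi.add_apply, Pi.smul_apply, smul_eq_mul]
    linarith [hlo c]
  · have h1 := (mul_mem_Icc_min_max hu (hz c)).2
    simp only [Pi.add_apply, Pi.smul_apply, smul_eq_mul]
    linarith [hhi c]

section Field

variable [Fintype ι] [DecidableEq ι] (Q : (ι → ℝ) →ₗ[ℝ] (ι → ℝ) →ₗ[ℝ] ι → ℝ)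
  {T : (ι → ℝ) → ℕ → ι → ℝ}

omit [Fintype ι] [DecidableEq ι] in
/-- **(E1) from endpoints**: an interval evaluation `qlo ≤ Q y y ≤ qhi` on the box and the two endpoint
inequalities give the hypothesis `henc` of `exists_sol_mem_Icc_of_roughEnclosure` (for this `x₀`). [folklore] -/
theorem roughEnclosure_of_endpoints {lo hi x₀ qlo qhi : ι → ℝ} {h : ℝ}
    (hq : ∀ y ∈ Icc lo hi, ∀ c, qlo c ≤ Q y y c ∧ Q y y c ≤ qhi c)
    (hlo : ∀ c, lo c ≤ x₀ c + min 0 (h * qlo c)) (hhi : ∀ c, x₀ c + max 0 (h * qhi c) ≤ hi c) :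
    ∀ y ∈ Icc lo hi, ∀ u ∈ Icc (0:ℝ) h, x₀ + u • Q y y ∈ Icc lo hi :=
  fun y hy _ hu => add_smul_mem_Icc_of_endpoints hu (hq y hy) hlo hhi

omit [Fintype ι] [DecidableEq ι] in
/-- **The Taylor polynomial minus its constant term is bounded by the coefficient bounds at `u = h`**:
`|Σ_{k≤p} T x₀ k c u^k − x₀ c| ≤ Σ_{1≤k≤p} R k c · h^k` for `u ∈ [0,h]`, given `T x₀ 0 = x₀` and `|T x₀ k c| ≤ R k c`
(`1 ≤ k ≤ p`). [folklore] -/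
theorem abs_taylorPoly_sub_le (hT0 : ∀ x, T x 0 = x) {x₀ : ι → ℝ} {p : ℕ} {R : ℕ → ι → ℝ} {c : ι}
    (hR : ∀ k ∈ Finset.Ico 1 (p + 1), |T x₀ k c| ≤ R k c) {h u : ℝ} (hu : u ∈ Icc 0 h) :
    |∑ k ∈ Finset.range (p + 1), T x₀ k c * u ^ k - x₀ c| ≤ ∑ k ∈ Finset.Ico 1 (p + 1), R k c * h ^ k := by
  have hsplit : ∑ k ∈ Finset.range (p + 1), T x₀ k c * u ^ k
      = x₀ c + ∑ k ∈ Finset.Ico 1 (p + 1), T x₀ k c * u ^ k := by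
    rw [Finset.range_eq_Ico, Finset.sum_eq_sum_Ico_succ_bot (Nat.succ_pos p), pow_zero, mul_one, hT0]
  rw [hsplit, add_sub_cancel_left]
  refine (Finset.abs_sum_le_sum_abs _ _).trans (Finset.sum_le_sum fun k hk => ?_)
  rw [abs_mul, abs_pow, abs_of_nonneg hu.1]
  have hRk : 0 ≤ R k c := (abs_nonneg _).trans (hR k hk)
  calc |T x₀ k c| * u ^ k ≤ R k c * u ^ k := mul_le_mul_of_nonneg_right (hR k hk) (pow_nonneg hu.1 _)
    _ ≤ R k c * h ^ k := mul_le_mul_of_nonneg_left (pow_le_pow_left₀ hu.1 hu.2 _) hRk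

omit [Fintype ι] [DecidableEq ι] in
/-- **(E2) from one endpoint inequality**: with coefficient bounds `|T x₀ k c| ≤ R k c` (`1 ≤ k ≤ p`) and
`0 ≤ J c`, the STRICT endpoint test `lo c < x₀ c − Σ_{1≤k≤p} R k c h^k − J c h^(p+1)`,
`x₀ c + Σ_{1≤k≤p} R k c h^k + J c h^(p+1) < hi c` implies the `∀ u ∈ [0,h]` test of
`exists_sol_mem_Icc_of_highOrderEnclosure` for this coordinate. [folklore] -/
theorem highOrderTest_of_endpoint (hT0 : ∀ x, T x 0 = x) {lo hi x₀ J : ι → ℝ} {p : ℕ} {R : ℕ → ι → ℝ}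
    {h : ℝ} {c : ι} (hR : ∀ k ∈ Finset.Ico 1 (p + 1), |T x₀ k c| ≤ R k c) (hJ : 0 ≤ J c)
    (hlo : lo c < x₀ c - ∑ k ∈ Finset.Ico 1 (p + 1), R k c * h ^ k - J c * h ^ (p + 1))
    (hhi : x₀ c + ∑ k ∈ Finset.Ico 1 (p + 1), R k c * h ^ k + J c * h ^ (p + 1) < hi c) :
    ∀ u ∈ Icc (0:ℝ) h,
      lo c < ∑ k ∈ Finset.range (p + 1), T x₀ k c * u ^ k - J c * u ^ (p + 1) ∧
      ∑ k ∈ Finset.range (p + 1), T x₀ k c * u ^ k + J c * u ^ (p + 1) < hi c := by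
  intro u hu
  have h1 := abs_le.1 (abs_taylorPoly_sub_le hT0 hR hu)
  have h2 : J c * u ^ (p + 1) ≤ J c * h ^ (p + 1) :=
    mul_le_mul_of_nonneg_left (pow_le_pow_left₀ hu.1 hu.2 _) hJ
  have h3 : 0 ≤ J c * u ^ (p + 1) := mul_nonneg hJ (pow_nonneg hu.1 _)
  constructor <;> linarith [h1.1, h1.2]

end Field

end Summit.NavierStokesRegularity.NavierStokesRegularity.Theorems.TaylorModelVector

end
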